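import Summits.QuantumFields.BalabanUV.T4Continuum.Support.ScalarCovariantLaplacianLaws

/-!
# T⁴ programme, spine node NE2 (U1a), owner row B8 «general rate» (OWNER RULING NE2 R17 (c), closer (M1′) of GAPS § G-ne2leaf08g2-1,
# STRUCTURE half), PART 3a — ROW B4.e's SCALAR-LAYER LAWS AT A GENERAL GEOMETRIC RATE `θ ∈ [L⁻¹, 1)`

NE2 formalisation swarm `b2b-balaban-t4-ne2-formalise-*`, leaf prover 05 (gen 4; lineage of row B4.b = the gauge slot that CONSUMES row B4.e's
END).  APPEND-ONLY TWIN of leaf-01's `Support/ScalarCovariantLaplacianLaws` (p211471): NO landed statement is edited; the instance of record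
(rate `L⁻¹`) is neither superseded nor weakened.  WHAT CHANGES: the two-spacing CONSISTENCY fields of the hypothesis shapes — connection
`‖w_{k+1}(x′) − w_k(par x′)‖`, zeroth-order field `‖z_{k+1}(x′) − z_k(par x′)‖`, site transport `‖T_{k+1}(x′) − T_k(par x′)‖` — are re-typed
from `·/n_k = ·L^{−k}` to `·θ^k` for a displayed rate `θ` (its `0 ≤ θ` a separate binder `hθ0`, owner R19 (b)(i)) (`ConnectionLaws0Rate`, `SiteTransportLaws0Rate`); SIZE and lattice-LIPSCHITZ
fields are UNCHANGED (regularity stays at the lattice scale; only the η-rate of the background moves — owner R17 (c), leaf-07-g3's part 1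
l.≈12075 for rows B2/B5).  WHAT IS RE-DERIVED, through the SAME per-level estimates of leaf-01's `ScalarPlantingConsistency`
(`opNorm_consistency0_le` / `opNorm_adjoint_consistency0_le` / `opNorm_zeroth_consistency0_le`, which take the two-level number `δ` as a
parameter) and the owner's rate-generic `GramPerturbationLaw.perturbationLaws_gramPert`:
 * `connectionLaws0Rate_of_lev` / `siteTransportLaws0Rate_of_lev`: the landed shapes ARE the `θ = L⁻¹` instances (`β′/n_k = β′·L⁻¹^k`), and
   `e2SR_invL_eq`: at `θ = L⁻¹` the rate sequence IS leaf-01's `e2S` (so the rate-`L⁻¹` case of the END below is leaf-01's END letter for letter —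
   not restated here, `dedup`);
 * `averagingLaws_Es_rate`: the transport errors `E_k = B_k(siteMul T_k − 1)` are an `AveragingLaws` family with sandwiched pairings `γ′⁻¹·τ′·θ^k`;
 * **`perturbationLaws_scalarLayer_rate (hd) (ha′) (hfree) (hR : ConnectionLaws0Rate L M Rb α β β′ ζ θ) (hT : SiteTransportLaws0Rate L M T τ τ′ θ) :
   PerturbationLaws (Δ′_k ⊗ 1) (scalarPert (lev L k) M a′ (R_k) (T_k)) (J₀,k ⊗ 1) (kappaS d a′ α β τ) (e2SR d L a′ α β β′ ζ τ τ′ θ e₀ e₁)`** —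
   row B4.e's END with the SAME `κ_s` and the (H-cons) sequence `e2SR` = `e2S` with `θ^k` in place of `n_k⁻¹`;
 * `e2SR_le_geom`: free defects `e₀ k ≤ C₀θ^k`, `e₁ k ≤ C₁θ^k` ⟹ `e2SR … k ≤ C2S … C₀ C₁ · θ^k` with leaf-01's constant `C2S` UNCHANGED
   (the free King-type defects `C·L^{−k}` feed it through `C·L^{−k} ≤ C·θ^k`, `NE2ColourPerturbedLayerRate.const_mul_invPow_le`).
Part 3b (`Support/GaugeTermSlotRateNumbers` + `Support/GaugeTermSlotRate`) carries this through row B4.b's gauge slot (`GaugeTermInstance(Geom)` / `GaugeTermBalabanData`) to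
`perturbationLaws_gaugeSlot_data_rate … (k ↦ C4S · θ^k)`.

HONEST FRAMING (T4-DAG p. 1).  Bookkeeping twin at MODEL LEVEL on OUR typed objects (transporters `R_k`, site transports `T_k`, mass `a′` DATA;
no B0, trigger c5); constants OURS; nothing of node NE3; ROOT B's conditional status (c1/c2/c3/c7) UNCHANGED; NE2 (U1a) NOT proved; spine
PROVED 0/9 unchanged; rung (B)+1 on one finite T⁴ — NOT infinite volume, NOT mass gap, NOT Clay.  HONEST DEPENDENCY: continuum YM on T⁴ ⇐
BetaPertH ∧ nine spine estimates (0/9 proved); BetaPertH ⇐ (D1) ∧ (D4) ∧ CAP+tail; G-an2-4 gates asym, D1 and NE2/3/4.  ABSOLUTE RULE kept; the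
two structures are hypothesis SHAPES on data (`structure … : Prop`), no `def … : Prop` fact; no `sorry`.
-/

noncomputable section

open scoped BigOperators ComplexConjugate Matrix Matrix.Norms.L2Operator Kronecker

namespace Summit.QuantumFields.BalabanUV.T4Continuum.ScalarCovariantLaplacianLawsRate

open Literature.MathematicalPhysics.QuantumFieldTheory.Balaban1983to89.B5Prop11Plancherel (Tor fine unitVec)
open Literature.MathematicalPhysics.QuantumFieldTheory.Balaban1983to89.B5Action121 (shiftS sdiff)
open Literature.MathematicalPhysics.QuantumFieldTheory.Balaban1983to89.B5G183RateUnitTower (lev lev_neZero)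
open Summit.QuantumFields.BalabanUV.T4Continuum
open Summit.QuantumFields.BalabanUV.T4Continuum.KroneckerLift
open Summit.QuantumFields.BalabanUV.T4Continuum.BlockMultiplication
open Summit.QuantumFields.BalabanUV.T4Continuum.BackgroundResolventTower
open Summit.QuantumFields.BalabanUV.T4Continuum.BalabanAveragedTowerUnit (one_le_lev' cast_lev')
open Summit.QuantumFields.BalabanUV.T4Continuum.BalabanAveragedTowerModes (par)
open Summit.QuantumFields.BalabanUV.T4Continuum.GramPerturbationLaw (AveragingLaws gramPert gramCore e2gram perturbationLaws_gramPert)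
open Summit.QuantumFields.BalabanUV.T4Continuum.ScalarAveragedPropagator (DeltaPs gammaPs Gps gammaPs_pos opNorm_Gps_le)
open Summit.QuantumFields.BalabanUV.T4Continuum.ScalarBlockPlanting (JK0 Pi0 JK0_mul_conjTranspose opNorm_JK0_le)
open Summit.QuantumFields.BalabanUV.T4Continuum.ScalarPlantingDefect (J0pcT)
open Summit.QuantumFields.BalabanUV.T4Continuum.ScalarCovariantLaplacian
open Summit.QuantumFields.BalabanUV.T4Continuum.ScalarPlantingFaces
open Summit.QuantumFields.BalabanUV.T4Continuum.ScalarPlantingConsistency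
open Summit.QuantumFields.BalabanUV.T4Continuum.ScalarCovariantLaplacianLaws

variable {d : ℕ}

section Tower

variable (L : ℕ) [NeZero L] (M : Fin d → ℕ) [hM : ∀ μ, NeZero (M μ)] {o : Type*} [Fintype o] [DecidableEq o]

/-! ## §1 The hypothesis shapes at a general rate `θ` -/

/-- **THE CONNECTION DATA OF THE SCALAR LAYER AT RATE `θ`** (hypothesis SHAPE on the bond transporters `R_k`, asserted by nobody): size `α`,
lattice-Lipschitz `β/n_k` (UNCHANGED), two-level consistencies of the connection `β′·θ^k` and of the zeroth-order field `ζ·θ^k`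
(`ScalarCovariantLaplacianLaws.ConnectionLaws0` is the `θ = L⁻¹` instance, `connectionLaws0Rate_of_lev`). [folklore] -/
structure ConnectionLaws0Rate (Rb : (k : ℕ) → Fin d → (Tor (fine (lev L k) M) → Matrix o o ℂ)) (α β β' ζ θ : ℝ) : Prop where
  /-- `α, β, β′, ζ ≥ 0` (the rate's `0 ≤ θ` is a separate binder `hθ0` of the theorems, owner R19 (b)(i)) -/
  nonneg : 0 ≤ α ∧ 0 ≤ β ∧ 0 ≤ β' ∧ 0 ≤ ζ
  /-- size -/
  bound : ∀ k μ x, ‖connS (fine (lev L k) M) ((lev L k : ℕ) : ℂ) (Rb k) μ x‖ ≤ α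
  /-- lattice-Lipschitz at spacing `L^{−k}` -/
  lipschitz : ∀ k μ ν x, ‖connS (fine (lev L k) M) ((lev L k : ℕ) : ℂ) (Rb k) μ (x + unitVec (fine (lev L k) M) ν)
    - connS (fine (lev L k) M) ((lev L k : ℕ) : ℂ) (Rb k) μ x‖ ≤ β / (lev L k : ℕ)
  /-- two-spacing consistency of the connection at the block parent, rate `θ` -/
  consistent : ∀ k μ (x' : Tor (fine (lev L (k + 1)) M)), ‖connS (fine (lev L (k + 1)) M) ((lev L (k + 1) : ℕ) : ℂ) (Rb (k + 1)) μ x'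
    - connS (fine (lev L k) M) ((lev L k : ℕ) : ℂ) (Rb k) μ (par (lev L k) L M x')‖ ≤ β' * θ ^ k
  /-- two-spacing consistency of the zeroth-order field at the block parent, rate `θ` -/
  zeroth_consistent : ∀ k (x' : Tor (fine (lev L (k + 1)) M)), ‖zfieldS (fine (lev L (k + 1)) M) ((lev L (k + 1) : ℕ) : ℂ) (Rb (k + 1)) x'
    - zfieldS (fine (lev L k) M) ((lev L k : ℕ) : ℂ) (Rb k) (par (lev L k) L M x')‖ ≤ ζ * θ ^ k

/-- **THE SITE-TRANSPORT DATA OF THE SCALAR LAYER AT RATE `θ`** (hypothesis SHAPE): `‖T_k(x) − 1‖ ≤ τ` and `‖T_{k+1}(x′) − T_k(par x′)‖ ≤ τ′·θ^k`.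
[folklore] -/
structure SiteTransportLaws0Rate (T : (k : ℕ) → (Tor (fine (lev L k) M) → Matrix o o ℂ)) (τ τ' θ : ℝ) : Prop where
  /-- `τ, τ′ ≥ 0` -/
  nonneg : 0 ≤ τ ∧ 0 ≤ τ'
  /-- small field -/
  sub_one_le : ∀ k x, ‖T k x - 1‖ ≤ τ
  /-- two-spacing consistency at the block parent, rate `θ` -/
  consistent : ∀ k (x' : Tor (fine (lev L (k + 1)) M)), ‖T (k + 1) x' - T k (par (lev L k) L M x')‖ ≤ τ' * θ ^ k

variable {L M}

omit [NeZero L] hM in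
/-- `x/n_k = x·L⁻¹^k`. [folklore] -/
theorem div_lev_eq (x : ℝ) (k : ℕ) : x / (lev L k : ℕ) = x * ((L : ℝ)⁻¹) ^ k := by
  rw [cast_lev', div_eq_mul_inv, ← inv_pow]

omit [NeZero L] hM in
/-- the landed connection shape IS the `θ = L⁻¹` instance. [folklore] -/
theorem connectionLaws0Rate_of_lev {Rb : (k : ℕ) → Fin d → (Tor (fine (lev L k) M) → Matrix o o ℂ)} {α β β' ζ : ℝ}
    (h : ConnectionLaws0 L M Rb α β β' ζ) : ConnectionLaws0Rate L M Rb α β β' ζ ((L : ℝ)⁻¹) where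
  nonneg := h.nonneg
  bound := h.bound
  lipschitz := h.lipschitz
  consistent k μ x' := by rw [← div_lev_eq]; exact h.consistent k μ x'
  zeroth_consistent k x' := by rw [← div_lev_eq]; exact h.zeroth_consistent k x'

omit [NeZero L] hM in
/-- the landed site-transport shape IS the `θ = L⁻¹` instance. [folklore] -/
theorem siteTransportLaws0Rate_of_lev {T : (k : ℕ) → (Tor (fine (lev L k) M) → Matrix o o ℂ)} {τ τ' : ℝ}
    (h : SiteTransportLaws0 L M T τ τ') : SiteTransportLaws0Rate L M T τ τ' ((L : ℝ)⁻¹) where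
  nonneg := h.nonneg
  sub_one_le := h.sub_one_le
  consistent k x' := by rw [← div_lev_eq]; exact h.consistent k x'

omit [NeZero L] hM in
/-- conversely, a rate-`θ` shape with `θ ≤ L⁻¹` is a landed-shape instance (rate monotonicity `τ′θ^k ≤ τ′L⁻¹^k = τ′/n_k`). [folklore] -/
theorem siteTransportLaws0_of_rate_le {T : (k : ℕ) → (Tor (fine (lev L k) M) → Matrix o o ℂ)} {τ τ' θ : ℝ}
    (h : SiteTransportLaws0Rate L M T τ τ' θ) (hθ0 : 0 ≤ θ) (hθL : θ ≤ (L : ℝ)⁻¹) : SiteTransportLaws0 L M T τ τ' where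
  nonneg := h.nonneg
  sub_one_le := h.sub_one_le
  consistent k x' := (h.consistent k x').trans (by
    rw [div_lev_eq]; exact mul_le_mul_of_nonneg_left (pow_le_pow_left₀ hθ0 hθL k) h.nonneg.2)

variable (L M)

/-! ## §2 The transport errors as an `AveragingLaws` family at rate `θ` -/

/-- **the transport errors are an `AveragingLaws` family**: size `τ`, sandwiched pairings `γ′⁻¹·τ′·θ^k`. [folklore] -/
theorem averagingLaws_Es_rate {a' : ℝ} (ha' : 0 < a') {T : (k : ℕ) → (Tor (fine (lev L k) M) → Matrix o o ℂ)} {τ τ' θ : ℝ}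
    (hθ0 : 0 ≤ θ) (hT : SiteTransportLaws0Rate L M T τ τ' θ) :
    AveragingLaws (fun k => DeltaPs (lev L k) M a' ⊗ₖ (1 : Matrix o o ℂ)) (Es L M T)
      (fun k => J0pcT L M k ⊗ₖ (1 : Matrix o o ℂ)) τ (fun k => (gammaPs d a')⁻¹ * (τ' * θ ^ k)) where
  opNorm_le := fun k => by
    have e : Es L M T k = Bs o (lev L k) M * siteMul (fun x => T k x - 1) := by rw [Es, siteMul_sub, siteMul_one]
    rw [e]
    exact (Matrix.l2_opNorm_mul _ _).trans ((mul_le_mul (opNorm_Bs_le o (lev L k) M) (opNorm_siteMul_le _ hT.nonneg.1 (hT.sub_one_le k))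
      (norm_nonneg _) zero_le_one).trans (le_of_eq (one_mul _)))
  pair_mul_inv_le := fun k => by
    have hg : 0 ≤ (gammaPs d a')⁻¹ := inv_nonneg.mpr (gammaPs_pos (d := d) (a' := a')).1.le
    have hδ : 0 ≤ τ' * θ ^ k := mul_nonneg hT.nonneg.2 (pow_nonneg hθ0 k)
    rw [Es_succ_mul_J0_sub, inv_DeltaPs_kron]
    calc _ ≤ ‖Bs o (lev L (k + 1)) M * siteMul (fun x' => T (k + 1) x' - T k (par (lev L k) L M x'))
            * (J0pcT L M k ⊗ₖ (1 : Matrix o o ℂ))‖ * ‖Gps (lev L k) M a' ⊗ₖ (1 : Matrix o o ℂ)‖ := Matrix.l2_opNorm_mul _ _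
      _ ≤ (1 * (τ' * θ ^ k) * 1) * (gammaPs d a')⁻¹ := by
          refine mul_le_mul ((Matrix.l2_opNorm_mul _ _).trans (mul_le_mul ((Matrix.l2_opNorm_mul _ _).trans (mul_le_mul
            (opNorm_Bs_le o _ M) (opNorm_siteMul_le _ hδ (hT.consistent k)) (norm_nonneg _) zero_le_one))
            (opNorm_kron_le_of_le o (opNorm_JK0_le (lev L k) L M)) (norm_nonneg _) (by positivity)))
            (opNorm_kron_le_of_le o (opNorm_Gps_le _ M ha')) (norm_nonneg _) (by positivity)
      _ = _ := by ring
  inv_mul_pair_le := fun k => by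
    have hg : 0 ≤ (gammaPs d a')⁻¹ := inv_nonneg.mpr (gammaPs_pos (d := d) (a' := a')).1.le
    have hδ : 0 ≤ τ' * θ ^ k := mul_nonneg hT.nonneg.2 (pow_nonneg hθ0 k)
    rw [Es_succ_mul_J0_sub, inv_DeltaPs_kron, Matrix.conjTranspose_mul, Matrix.conjTranspose_mul, ← Matrix.mul_assoc, ← Matrix.mul_assoc]
    calc _ ≤ ‖Gps (lev L k) M a' ⊗ₖ (1 : Matrix o o ℂ) * (J0pcT L M k ⊗ₖ (1 : Matrix o o ℂ))ᴴ
            * (siteMul (fun x' => T (k + 1) x' - T k (par (lev L k) L M x')))ᴴ‖ * ‖(Bs o (lev L (k + 1)) M)ᴴ‖ := Matrix.l2_opNorm_mul _ _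
      _ ≤ ((gammaPs d a')⁻¹ * 1 * (τ' * θ ^ k)) * 1 := by
          refine mul_le_mul ((Matrix.l2_opNorm_mul _ _).trans (mul_le_mul ((Matrix.l2_opNorm_mul _ _).trans (mul_le_mul
            (opNorm_kron_le_of_le o (opNorm_Gps_le _ M ha')) ?_ (norm_nonneg _) hg)) ?_ (norm_nonneg _) (by positivity))) ?_
            (norm_nonneg _) (by positivity)
          · rw [Matrix.l2_opNorm_conjTranspose]; exact opNorm_kron_le_of_le o (opNorm_JK0_le (lev L k) L M)
          · rw [Matrix.l2_opNorm_conjTranspose]; exact opNorm_siteMul_le _ hδ (hT.consistent k)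
          · rw [Matrix.l2_opNorm_conjTranspose]; exact opNorm_Bs_le o _ M
      _ = _ := by ring

/-! ## §3 THE END at rate `θ` -/

/-- **the consistency sequence of the scalar layer at rate `θ`** (DISPLAYED; `g = γ′⁻¹`): leaf-01's `e2S` with `θ^k` in place of `n_k⁻¹` —
`(d·L·g·√g·β′ + d·√g·g·β′ + g²·ζ)·θ^k + (d(L+1)α√g + d(L+1)(α√g + βg))·e₀ k + a′·e2gram g 1 τ e₀ e₁ 0 (g·τ′·θ^k) k`. [folklore] -/
def e2SR (d L : ℕ) (a' α β β' ζ τ τ' θ : ℝ) (e₀ e₁ : ℕ → ℝ) (k : ℕ) : ℝ :=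
  (d * (L * (gammaPs d a')⁻¹ * Real.sqrt ((gammaPs d a')⁻¹) * β') + d * (Real.sqrt ((gammaPs d a')⁻¹) * (gammaPs d a')⁻¹ * β')
      + (gammaPs d a')⁻¹ * (gammaPs d a')⁻¹ * ζ) * θ ^ k
    + (d * ((L + 1) * α * Real.sqrt ((gammaPs d a')⁻¹)) + d * ((L + 1) * (α * Real.sqrt ((gammaPs d a')⁻¹) + β * (gammaPs d a')⁻¹))) * e₀ k
    + a' * e2gram (gammaPs d a')⁻¹ 1 τ e₀ e₁ (fun _ => 0) (fun j => (gammaPs d a')⁻¹ * (τ' * θ ^ j)) k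

omit [NeZero L] hM in
/-- at `θ = L⁻¹` the rate sequence IS leaf-01's `e2S`. [folklore] -/
theorem e2SR_invL_eq (a' α β β' ζ τ τ' : ℝ) (e₀ e₁ : ℕ → ℝ) (k : ℕ) :
    e2SR d L a' α β β' ζ τ τ' ((L : ℝ)⁻¹) e₀ e₁ k = e2S d L a' α β β' ζ τ τ' e₀ e₁ k := by
  unfold e2SR e2S
  simp only [div_lev_eq]

omit [NeZero L] hM in
/-- **GEOMETRIC CONSISTENCY AT RATE `θ`**: free defects `e₀ k ≤ C₀θ^k`, `e₁ k ≤ C₁θ^k` give `e2SR … k ≤ C2S … C₀ C₁ · θ^k` — leaf-01's constant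
`C2S` UNCHANGED. [folklore] -/
theorem e2SR_le_geom {a' α β β' ζ τ τ' θ C₀ C₁ : ℝ} (ha' : 0 < a') (hα : 0 ≤ α) (hβ : 0 ≤ β) (hτ : 0 ≤ τ) {e₀ e₁ : ℕ → ℝ}
    (h₀ : ∀ k, e₀ k ≤ C₀ * θ ^ k) (h₁ : ∀ k, e₁ k ≤ C₁ * θ ^ k) (k : ℕ) :
    e2SR d L a' α β β' ζ τ τ' θ e₀ e₁ k ≤ C2S d L a' α β β' ζ τ τ' C₀ C₁ * θ ^ k := by
  have hg : 0 ≤ (gammaPs d a')⁻¹ := inv_nonneg.mpr (gammaPs_pos (d := d) (a' := a')).1.le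
  have hG : e2gram (gammaPs d a')⁻¹ 1 τ e₀ e₁ (fun _ => 0) (fun j => (gammaPs d a')⁻¹ * (τ' * θ ^ j)) k
      ≤ GramPerturbationLaw.C2gram (gammaPs d a')⁻¹ 1 τ C₀ C₁ 0 ((gammaPs d a')⁻¹ * τ') * θ ^ k :=
    GramPerturbationLaw.e2gram_le_geom hg zero_le_one hτ h₀ h₁ (fun j => by show (0 : ℝ) ≤ 0 * _; simp)
      (fun j => le_of_eq (by ring)) k
  have hB : 0 ≤ d * ((L + 1) * α * Real.sqrt ((gammaPs d a')⁻¹))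
      + d * ((L + 1) * (α * Real.sqrt ((gammaPs d a')⁻¹) + β * (gammaPs d a')⁻¹)) := by positivity
  unfold e2SR C2S
  refine (add_le_add (add_le_add le_rfl (mul_le_mul_of_nonneg_left (h₀ k) hB)) (mul_le_mul_of_nonneg_left hG ha'.le)).trans
    (le_of_eq ?_)
  ring

/-- `‖(−X)ᴴ‖ = ‖X‖`. [folklore] -/
private theorem norm_negH (X : Matrix o o ℂ) : ‖(-X)ᴴ‖ = ‖X‖ := by
  rw [Matrix.conjTranspose_neg, norm_neg, Matrix.l2_opNorm_conjTranspose]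

omit [Fintype o] [DecidableEq o] in
/-- `(−X)ᴴ − (−Y)ᴴ = (−(X − Y))ᴴ`. [folklore] -/
private theorem sub_negH (X Y : Matrix o o ℂ) : (-X)ᴴ - (-Y)ᴴ = (-(X - Y))ᴴ := by
  simp only [Matrix.conjTranspose_neg, Matrix.conjTranspose_sub, neg_sub]; abel

/-- `‖−X − (−Y)‖ = ‖X − Y‖`. [folklore] -/
private theorem norm_neg_sub_neg (X Y : Matrix o o ℂ) : ‖-X - -Y‖ = ‖X - Y‖ := by
  rw [← norm_neg (X - Y)]; congr 1; abel

/-- **ROW B4.e's END AT A GENERAL RATE `θ` — `PerturbationLaws` FOR THE SCALAR LAYER.**  Given ANY lifted free scalar tower `hfree` (row B4.d's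
`FreeTowerLaws` for `Δ′_k`, King's 0-form plantings `J₀,k`; only its complement / injected numbers `e₀`, `e₁` and `‖J₀‖ ≤ 1` are used), connection
data `(α, β, β′, ζ)` AT RATE `θ` and site-transport data `(τ, τ′)` AT RATE `θ`:
`PerturbationLaws (Δ′_k ⊗ 1) (scalarPert (lev L k) M a′ (R_k) (T_k)) (J₀,k ⊗ 1) (kappaS d a′ α β τ) (e2SR d L a′ α β β′ ζ τ τ′ θ e₀ e₁)` — the
proof of `ScalarCovariantLaplacianLaws.perturbationLaws_scalarLayer` VERBATIM with the two-level numbers `β′θ^k`, `ζθ^k`, `τ′θ^k` fed to the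
same per-level estimates.  NOT NE2; model level. [cite: Balaban1985BackgroundPropagators, (3.19) p.393, (3.24) p.394 (shapes); King1986, (2.10) p.653 (planting)] [folklore] -/
theorem perturbationLaws_scalarLayer_rate (hd : 1 ≤ d) {a' : ℝ} (ha' : 0 < a')
    {A : (k : ℕ) → Matrix (Tor (fine (lev L k) M) × o) (Tor (fine (lev L (k + 1)) M) × o) ℂ}
    {F : (k : ℕ) → Matrix (Tor (fine (lev L k) M) × o) (Tor (fine (lev L k) M) × o) ℂ} {r : ℝ} {e₀ e₁ f₀ : ℕ → ℝ}
    (hfree : FreeTowerLaws (fun k => DeltaPs (lev L k) M a' ⊗ₖ (1 : Matrix o o ℂ)) A (fun k => J0pcT L M k ⊗ₖ (1 : Matrix o o ℂ)) F r e₀ e₁ f₀)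
    {Rb : (k : ℕ) → Fin d → (Tor (fine (lev L k) M) → Matrix o o ℂ)} {T : (k : ℕ) → (Tor (fine (lev L k) M) → Matrix o o ℂ)}
    {α β β' ζ τ τ' θ : ℝ} (hθ0 : 0 ≤ θ) (hR : ConnectionLaws0Rate L M Rb α β β' ζ θ) (hT : SiteTransportLaws0Rate L M T τ τ' θ) :
    PerturbationLaws (fun k => DeltaPs (lev L k) M a' ⊗ₖ (1 : Matrix o o ℂ)) (fun k => scalarPert (lev L k) M a' (Rb k) (T k))
      (fun k => J0pcT L M k ⊗ₖ (1 : Matrix o o ℂ)) (kappaS d a' α β τ) (e2SR d L a' α β β' ζ τ τ' θ e₀ e₁) where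
  opNorm_P_mul_inv_le := fun k =>
    opNorm_scalarPert_mul_inv_le (lev L k) M ha' hR.nonneg.1 hR.nonneg.2.1 hT.nonneg.1 (hR.bound k) (hR.lipschitz k) (hT.sub_one_le k)
  opNorm_inv_mul_P_le := fun k =>
    opNorm_inv_mul_scalarPert_le (lev L k) M ha' hR.nonneg.1 hR.nonneg.2.1 hT.nonneg.1 (hR.bound k) (hR.lipschitz k) (hT.sub_one_le k)
  consistent_le := fun k => by
    obtain ⟨hα, hβ, hβ', hζ⟩ := hR.nonneg
    have hθ := hθ0
    have hn : (0 : ℝ) < (lev L k : ℕ) := by exact_mod_cast one_le_lev' L k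
    have hγ : ∀ j, ‖(DeltaPs (lev L j) M a' ⊗ₖ (1 : Matrix o o ℂ))⁻¹‖ ≤ (gammaPs d a')⁻¹ := fun j => by
      rw [inv_DeltaPs_kron]; exact opNorm_kron_le_of_le o (opNorm_Gps_le _ M ha')
    -- the Gram summand, from `GramPerturbationLaw`
    have hG := (perturbationLaws_gramPert hfree hγ (averagingLaws_Bs L M a') (averagingLaws_Es_rate L M ha' hθ0 hT) ((a' : ℝ) : ℂ)).consistent_le k
    simp only [gramPert, gramCore, Bs_add_Es, inv_DeltaPs_kron, Complex.norm_real, Real.norm_of_nonneg ha'.le] at hG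
    -- the complement number of the free tower in the two-level currency
    have hc0 := hfree.complement_le k
    simp only [inv_DeltaPs_kron, kron_conjTranspose] at hc0
    rw [← kron_mul, J0pcT_mul_conjTranspose] at hc0
    have hc : ‖(Gps (L * lev L k) M a' * (1 - Pi0 (lev L k) L M)) ⊗ₖ (1 : Matrix o o ℂ)‖ ≤ e₀ k := by
      rw [kron_mul, sub_kronecker, Matrix.one_kronecker_one]; exact hc0
    -- the three local pieces
    have h1 : ‖Gps (lev L (k + 1)) M a' ⊗ₖ (1 : Matrix o o ℂ)
        * (Fshape (fine (lev L (k + 1)) M) ((lev L (k + 1) : ℕ) : ℂ) (Rb (k + 1)) * J0pcT L M k ⊗ₖ (1 : Matrix o o ℂ)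
          - J0pcT L M k ⊗ₖ (1 : Matrix o o ℂ) * Fshape (fine (lev L k) M) ((lev L k : ℕ) : ℂ) (Rb k))
        * (Gps (lev L k) M a' ⊗ₖ (1 : Matrix o o ℂ))‖
        ≤ d * (L * (gammaPs d a')⁻¹ * (β' * θ ^ k) * Real.sqrt ((gammaPs d a')⁻¹)
          + e₀ k * (L + 1) * α * Real.sqrt ((gammaPs d a')⁻¹)) := by
      rw [Fshape, Fshape]
      refine (opNorm_cons_sum_le _ _ _ _ _ _).trans ?_
      have hterm : ∀ μ ∈ Finset.univ, ‖Gps (lev L (k + 1)) M a' ⊗ₖ (1 : Matrix o o ℂ)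
          * (siteMul (fun x => -(connS (fine (lev L (k + 1)) M) ((lev L (k + 1) : ℕ) : ℂ) (Rb (k + 1)) μ x))
              * sdiff (fine (lev L (k + 1)) M) ((lev L (k + 1) : ℕ) : ℂ) μ ⊗ₖ (1 : Matrix o o ℂ) * J0pcT L M k ⊗ₖ (1 : Matrix o o ℂ)
            - J0pcT L M k ⊗ₖ (1 : Matrix o o ℂ) * (siteMul (fun x => -(connS (fine (lev L k) M) ((lev L k : ℕ) : ℂ) (Rb k) μ x))
              * sdiff (fine (lev L k) M) ((lev L k : ℕ) : ℂ) μ ⊗ₖ (1 : Matrix o o ℂ)))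
          * (Gps (lev L k) M a' ⊗ₖ (1 : Matrix o o ℂ))‖
          ≤ L * (gammaPs d a')⁻¹ * (β' * θ ^ k) * Real.sqrt ((gammaPs d a')⁻¹)
            + e₀ k * (L + 1) * α * Real.sqrt ((gammaPs d a')⁻¹) := by
        intro μ _
        refine opNorm_consistency0_le (lev L k) L M hd (one_le_lev' L k) ha' μ hα (mul_nonneg hβ' (pow_nonneg hθ k)) (fun x => ?_) (fun x' => ?_) hc
        · simpa only [norm_neg] using hR.bound k μ x
        · simpa only [norm_neg_sub_neg] using hR.consistent k μ x'
      refine (Finset.sum_le_sum hterm).trans (le_of_eq ?_)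
      rw [Finset.sum_const, Finset.card_univ, Fintype.card_fin, nsmul_eq_mul]
    have h2 : ‖Gps (lev L (k + 1)) M a' ⊗ₖ (1 : Matrix o o ℂ)
        * ((Fshape (fine (lev L (k + 1)) M) ((lev L (k + 1) : ℕ) : ℂ) (Rb (k + 1)))ᴴ * J0pcT L M k ⊗ₖ (1 : Matrix o o ℂ)
          - J0pcT L M k ⊗ₖ (1 : Matrix o o ℂ) * (Fshape (fine (lev L k) M) ((lev L k : ℕ) : ℂ) (Rb k))ᴴ)
        * (Gps (lev L k) M a' ⊗ₖ (1 : Matrix o o ℂ))‖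
        ≤ d * (Real.sqrt ((gammaPs d a')⁻¹) * (β' * θ ^ k) * (gammaPs d a')⁻¹
          + e₀ k * (L + 1) * (α * Real.sqrt ((gammaPs d a')⁻¹) + β * (gammaPs d a')⁻¹)) := by
      rw [FshapeH_eq, FshapeH_eq]
      refine (opNorm_cons_sum_le _ _ _ _ _ _).trans ?_
      have hterm : ∀ μ ∈ Finset.univ, ‖Gps (lev L (k + 1)) M a' ⊗ₖ (1 : Matrix o o ℂ)
          * ((sdiff (fine (lev L (k + 1)) M) ((lev L (k + 1) : ℕ) : ℂ) μ ⊗ₖ (1 : Matrix o o ℂ))ᴴ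
              * siteMul (fun x => (-(connS (fine (lev L (k + 1)) M) ((lev L (k + 1) : ℕ) : ℂ) (Rb (k + 1)) μ x))ᴴ)
              * J0pcT L M k ⊗ₖ (1 : Matrix o o ℂ)
            - J0pcT L M k ⊗ₖ (1 : Matrix o o ℂ) * ((sdiff (fine (lev L k) M) ((lev L k : ℕ) : ℂ) μ ⊗ₖ (1 : Matrix o o ℂ))ᴴ
              * siteMul (fun x => (-(connS (fine (lev L k) M) ((lev L k : ℕ) : ℂ) (Rb k) μ x))ᴴ)))
          * (Gps (lev L k) M a' ⊗ₖ (1 : Matrix o o ℂ))‖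
          ≤ Real.sqrt ((gammaPs d a')⁻¹) * (β' * θ ^ k) * (gammaPs d a')⁻¹
            + e₀ k * (L + 1) * (α * Real.sqrt ((gammaPs d a')⁻¹) + β * (gammaPs d a')⁻¹) := by
        intro μ _
        refine opNorm_adjoint_consistency0_le (lev L k) L M hd (one_le_lev' L k) ha' μ hα hβ (mul_nonneg hβ' (pow_nonneg hθ k)) (fun x => ?_)
          (fun x => ?_) (fun x' => ?_) hc
        · simpa only [norm_negH] using hR.bound k μ x
        · simpa only [sub_negH, norm_negH] using hR.lipschitz k μ μ x
        · simpa only [Function.comp_apply, sub_negH, norm_negH] using hR.consistent k μ x'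
      refine (Finset.sum_le_sum hterm).trans (le_of_eq ?_)
      rw [Finset.sum_const, Finset.card_univ, Fintype.card_fin, nsmul_eq_mul]
    have h3 : ‖Gps (lev L (k + 1)) M a' ⊗ₖ (1 : Matrix o o ℂ)
        * (siteMul (zfieldS (fine (lev L (k + 1)) M) ((lev L (k + 1) : ℕ) : ℂ) (Rb (k + 1))) * J0pcT L M k ⊗ₖ (1 : Matrix o o ℂ)
          - J0pcT L M k ⊗ₖ (1 : Matrix o o ℂ) * siteMul (zfieldS (fine (lev L k) M) ((lev L k : ℕ) : ℂ) (Rb k)))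
        * (Gps (lev L k) M a' ⊗ₖ (1 : Matrix o o ℂ))‖
        ≤ (gammaPs d a')⁻¹ * (ζ * θ ^ k) * (gammaPs d a')⁻¹ :=
      opNorm_zeroth_consistency0_le (lev L k) L M ha' (mul_nonneg hζ (pow_nonneg hθ k)) (hR.zeroth_consistent k)
    -- assemble
    rw [inv_DeltaPs_kron, inv_DeltaPs_kron, scalarPert_eq, scalarPert_eq]
    refine ((opNorm_cons_add_le _ _ _ _ _ _ _).trans (add_le_add ((opNorm_cons_add_le _ _ _ _ _ _ _).trans
      (add_le_add ((opNorm_cons_add_le _ _ _ _ _ _ _).trans (add_le_add h1 h2)) h3)) hG)).trans (le_of_eq ?_)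
    unfold e2SR
    ring


end Tower

end Summit.QuantumFields.BalabanUV.T4Continuum.ScalarCovariantLaplacianLawsRate

end
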